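/-
Copyright: see repository. [cite: CossartPiltant2008, Section 9, Lemma 9.4 (HAL p. 29 l. 48–59)]
[cite: Matsumura1987, Theorem 5.1 (Section 5)]
-/
import Literature.AlgebraicGeometry.CossartPiltant200819.MonomialChartMatsumura2008
import HarnessLib

/-!
# [CP-I] Lemma 9.4, §9 monomial chart: the centre node `MonomialChartCentre` DISCHARGED

`MonomialChartCentre` (`MonomialChartCentre2008`: for a regular local model `S` of `W` with r.s.p.
`x`, a unimodular `V` with inverse `C ≥ 0`, `y := x^V ⊆ W` and ANY coefficient ring `F ⊆ S`
surjecting onto `κ(S)`, the maximal ideal of the pinned chart `S₁ = (S[y])_{m_W ∩ S[y]}` is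
generated by the `y_i` with `W(y_i) > 0` and `#I₀`-many values `P_j(y_{I₀})` of polynomials with
coefficients in `F` — [CP-I] HAL p. 29 l. 48–59, including the lifting "there exist `γ₂, γ₃ ∈ R₁`"
of l. 55–56) was left a named fact although the tree proves the whole chain below it:
Matsumura's Thm. 5.1 (ii) `kernelAtAlgebraicPoint` ⟹ `monomialChartKernel`
(`MonomialChartMatsumura2008`) ⟹ `MonomialChartCentreSelf` (`monomialChartCentreSelf_of_kernel`,
`MonomialChartKernel2008`) ⟹ `MonomialChartCentre` (`monomialChartCentre_of_self`,
`MonomialChartLift2008`).  One-line discharge; no definitions, no new named facts.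
[cite: CossartPiltant2008, Section 9, Lemma 9.4 (HAL p. 29 l. 48–59)]
[cite: Matsumura1987, Theorem 5.1 (ii) (Section 5)]
-/

namespace Literature.AlgebraicGeometry.CossartPiltant200819.CP2008

universe u

/-- **Node N2a `MonomialChartCentre` DISCHARGED** ([CP-I] HAL p. 29 l. 48–59: the maximal ideal of
`S₁ := S̄_{m_W ∩ S̄}`, `S̄ = S[y₁, y₂, y₃]`, is `(y_{I₊}, P_j(y_{I₀}))` with the coefficients of the
`P_j` taken in a prescribed coefficient ring `F ↠ κ(S)`), from the proved kernel leaf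
`monomialChartKernel` (Matsumura Thm. 5.1 (ii)) through `monomialChartCentreSelf_of_kernel` and the
proved coefficient-lifting glue `monomialChartCentre_of_self`.
[cite: CossartPiltant2008, Section 9, Lemma 9.4 (HAL p. 29 l. 48–59)]
[cite: Matsumura1987, Theorem 5.1 (ii) (Section 5)] -/
theorem MonomialChartCentre_holds : MonomialChartCentre.{u} :=
  monomialChartCentre_of_self (monomialChartCentreSelf_of_kernel monomialChartKernel)

end Literature.AlgebraicGeometry.CossartPiltant200819.CP2008
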